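import Literature.Probability.RandomPlanarGeometry.SAWTriangularDetourSurgery
import Literature.Probability.RandomPlanarGeometry.SAWTriangularBrickWalks
import HarnessLib

/-!
# Kesten's detour surgery restricted to self-avoiding LOOPS of the triangular lattice («TRI-SAP-RATIO», crux K82 — base)

Topic `Literature/Probability/RandomPlanarGeometry` (lane «pcv-sawmu», route R82 «TRI-SAP-RATIO(-RATE)»: the one-step
ratio theorem `q_{N+1}(𝕋)/q_N(𝕋) → μ(𝕋)` for self-avoiding polygons on `𝕋`). Sources: N. Madras, G. Slade, *The
Self-Avoiding Walk* (1993), §7.3, proof of Theorem 7.3.2 (the pairs `(walk, insertion site)` counted two ways,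
(7.3.5)–(7.3.7)), Theorem 7.4.5 (c) p. 254 (the fixed-endpoint / polygon ratio theorem on `ℤ^d`).

A rooted oriented self-avoiding polygon of length `M + 1` on `𝕋` is an `M`-step self-avoiding walk from `0` whose last
vertex is a neighbour of `0` (the lane's `triLoopCount (M+1) = #((brickSaws M).filter fun ω => brickGraph.Adj (ω M) 0)`,
planner a-idea-1's R81/R82 token, read in a-p3's brick frame). This file restricts the tree's triangle-detour surgery
`triIns` / `triDel` of `SAWTriangularDetourSurgery.lean` (a-p5, C1 BASE) to this LOOP carrier in the list model: an
interior detour insertion or deletion keeps BOTH endpoints, so closure is immediate (no window, no defect — contrast the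
bridge case `HexSAWBrickWallBridgeSurgery.lean`); the pair bijection and the bookkeeping constants of the BASE carry over
verbatim, and the two transfer counts (P1-L), (P2-L) are the tree's `triKesten_P1'` / `triKesten_P2` over the loop carrier.

## Contents (namespace `Literature.Probability.RandomPlanarGeometry.SAW`; all PROVED, axioms standard)

* **`loopSL M`** (M-step walks from `0` ending next to `0`), `mem_loopSL`, `loopSL_subset`,
  **`card_loopSL : #(loopSL M) = #((brickSaws M).filter fun ω => brickGraph.Adj (ω M) 0)`**;
* laws `triIns_mem_loopSL`, `triDel_mem_loopSL`; pairs `loopSlotPairs`, `loopSharpPairs`, `sum_loopSlotPairs`,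
  `sum_loopSharpPairs`, **`sum_loopSlotPairs_eq_sum_loopSharpPairs`**;
* transfers **`loopKesten_P1'`** (`c₁ = 2`), `sum_card_triSlots_div_le_card_loopSL`, **`loopKesten_P2`**
  (`I·max(0, I−8)/((J+3)(J+6))`).
-/

noncomputable section

open Finset Literature.Probability.LatticeModels Literature.Probability.Percolation SimpleGraph
open scoped BigOperators

namespace Literature.Probability.RandomPlanarGeometry.SAW

/-! ### The loop carrier -/

open Classical in
/-- The `M`-step self-avoiding walks of `𝕋` from `0` whose last vertex is adjacent to `0` (= rooted oriented
self-avoiding polygons of length `M + 1`, the closing edge being `(ω_M, 0)`). [cite: MadrasSlade1993, §3.2 (3.2.1)] -/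
def loopSL (M : ℕ) : Finset (List (Site 2)) := (triSL M).filter fun ω => triGraph.Adj (ω.getD M 0) 0

/-- Membership in `loopSL`. [cite: MadrasSlade1993, §3.2 (3.2.1)] -/
theorem mem_loopSL {M : ℕ} {ω : List (Site 2)} : ω ∈ loopSL M ↔ ω ∈ triSL M ∧ triGraph.Adj (ω.getD M 0) 0 := by
  classical
  exact Finset.mem_filter

/-- `loopSL M ⊆ triSL M`. [cite: MadrasSlade1993, §3.2] -/
theorem loopSL_subset (M : ℕ) : loopSL M ⊆ triSL M := fun _ h => (mem_loopSL.1 h).1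

open Classical in
/-- **Transport to the brick frame**: `#(loopSL M) = #{ω ∈ brickSaws M : ω M ~ 0}` (the R81/R82 token
`triLoopCount (M+1)`). [cite: MadrasSlade1993, §3.2 (3.2.1)] -/
theorem card_loopSL (M : ℕ) : #(loopSL M) = #((brickSaws M).filter fun ω => brickGraph.Adj (ω M) 0) := by
  have e : ∀ x : Site 2, brickGraph.Adj (toBrick x) 0 ↔ triGraph.Adj x 0 := fun x => by
    have h := brickGraph_adj_toBrick x 0
    rwa [toBrick_zero] at h
  rw [brickSaws, Finset.filter_image, Finset.card_image_of_injOn]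
  · congr 1
    ext l
    simp only [loopSL, Finset.mem_filter, brickFun_apply, min_self, e]
  · exact (brickFun_injOn M).mono (Finset.coe_subset.2 (Finset.filter_subset _ _))

/-! ### Laws: interior detours keep both endpoints -/

section Laws

variable {M : ℕ} {ω : List (Site 2)} {m : ℕ} {z : Site 2}

/-- Detour insertion at a slot of a loop gives a loop. [cite: MadrasSlade1993, §7.3 (proof of Theorem 7.3.2)] -/
theorem triIns_mem_loopSL (hω : ω ∈ loopSL M) (hs : (m, z) ∈ triSlots ω) : triIns m z ω ∈ loopSL (M + 1) := by
  obtain ⟨hωS, hlast⟩ := mem_loopSL.1 hω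
  obtain ⟨hm, -, -, -⟩ := mem_triSlots.1 hs
  have hl := length_of_mem_triSL hωS
  refine mem_loopSL.2 ⟨triIns_mem_triSL hωS hs, ?_⟩
  rw [getD_triIns_of_lt (by omega), show M + 1 - 1 = M by omega]
  exact hlast

/-- Detour deletion at a sharp turn of a loop gives a loop. [cite: MadrasSlade1993, §7.3 (proof of Theorem 7.3.2)] -/
theorem triDel_mem_loopSL (hω : ω ∈ loopSL (M + 1)) (hm : m ∈ triSharp ω) : triDel m ω ∈ loopSL M := by
  obtain ⟨hωS, hlast⟩ := mem_loopSL.1 hω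
  obtain ⟨hml, -⟩ := mem_triSharp.1 hm
  have hl := length_of_mem_triSL hωS
  refine mem_loopSL.2 ⟨triDel_mem_triSL hωS hm, ?_⟩
  rw [getD_triDel_of_lt (by omega)]
  exact hlast

end Laws

/-! ### Counting the pairs in two ways over loops -/

section Pairs

/-- The slot pairs over loops. [cite: MadrasSlade1993, §7.3 (proof of Theorem 7.3.2), (7.3.5)] -/
def loopSlotPairs (M : ℕ) : Finset (Σ _ : List (Site 2), ℕ × Site 2) := (loopSL M).sigma fun ω => triSlots ω

/-- The sharp-turn pairs over loops. [cite: MadrasSlade1993, §7.3 (proof of Theorem 7.3.2), (7.3.5)] -/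
def loopSharpPairs (M : ℕ) : Finset (Σ _ : List (Site 2), ℕ) := (loopSL M).sigma fun ω => triSharp ω

/-- Summing over loop slot pairs is summing `I(ω) · F(ω)` over loops. [cite: MadrasSlade1993, §7.3 (proof of Theorem 7.3.2)] -/
theorem sum_loopSlotPairs (M : ℕ) (F : List (Site 2) → ℝ) :
    ∑ p ∈ loopSlotPairs M, F p.1 = ∑ ω ∈ loopSL M, (#(triSlots ω) : ℝ) * F ω := by
  rw [loopSlotPairs, Finset.sum_sigma]
  refine sum_congr rfl fun ω _ => ?_
  change ∑ s ∈ triSlots ω, F ω = _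
  rw [sum_const, nsmul_eq_mul]

/-- Summing over loop sharp-turn pairs is summing `J(ω) · F(ω)` over loops. [cite: MadrasSlade1993, §7.3 (proof of Theorem 7.3.2)] -/
theorem sum_loopSharpPairs (M : ℕ) (F : List (Site 2) → ℝ) :
    ∑ q ∈ loopSharpPairs M, F q.1 = ∑ ω ∈ loopSL M, (#(triSharp ω) : ℝ) * F ω := by
  rw [loopSharpPairs, Finset.sum_sigma]
  refine sum_congr rfl fun ω _ => ?_
  change ∑ s ∈ triSharp ω, F ω = _
  rw [sum_const, nsmul_eq_mul]

/-- **Counting the pairs in two ways over loops**: `(ω, (m, z)) ↦ (triIns m z ω, m)` is a bijection from the slot pairs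
of `loopSL M` onto the sharp-turn pairs of `loopSL (M+1)`. [cite: MadrasSlade1993, §7.3 (proof of Theorem 7.3.2), (7.3.5)–(7.3.6)] -/
theorem sum_loopSlotPairs_eq_sum_loopSharpPairs (M : ℕ) (F : (Σ _ : List (Site 2), ℕ × Site 2) → ℝ)
    (G : (Σ _ : List (Site 2), ℕ) → ℝ) (h : ∀ p ∈ loopSlotPairs M, F p = G ⟨triIns p.2.1 p.2.2 p.1, p.2.1⟩) :
    ∑ p ∈ loopSlotPairs M, F p = ∑ q ∈ loopSharpPairs (M + 1), G q := by
  refine Finset.sum_nbij' (fun p => ⟨triIns p.2.1 p.2.2 p.1, p.2.1⟩)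
    (fun q => ⟨triDel q.2 q.1, (q.2, q.1.getD (q.2 + 1) 0)⟩) ?_ ?_ ?_ ?_ h
  · rintro ⟨ω, m, z⟩ hp
    rw [loopSlotPairs, Finset.mem_sigma] at hp
    rw [loopSharpPairs, Finset.mem_sigma]
    exact ⟨triIns_mem_loopSL hp.1 hp.2, mem_triSharp_triIns (loopSL_subset _ hp.1) hp.2⟩
  · rintro ⟨ω, m⟩ hq
    rw [loopSharpPairs, Finset.mem_sigma] at hq
    rw [loopSlotPairs, Finset.mem_sigma]
    exact ⟨triDel_mem_loopSL hq.1 hq.2, mem_triSlots_triDel (loopSL_subset _ hq.1) hq.2⟩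
  · rintro ⟨ω, m, z⟩ hp
    rw [loopSlotPairs, Finset.mem_sigma] at hp
    dsimp only at hp
    obtain ⟨hm, -, -, -⟩ := mem_triSlots.1 hp.2
    dsimp only
    rw [triDel_triIns, getD_triIns_self (by omega)]
  · rintro ⟨ω, m⟩ hq
    rw [loopSharpPairs, Finset.mem_sigma] at hq
    dsimp only at hq
    obtain ⟨hml, -⟩ := mem_triSharp.1 hq.2
    dsimp only
    rw [triIns_triDel (by omega)]

end Pairs

/-! ### The transfer counts over loops -/

section TransferL

/-- **(P1-L)**: `#{ω' ∈ loopSL (M+1) : J(ω') ≥ 1} ≤ Σ_{ω ∈ loopSL M} I(ω)/max(J(ω) − 2, 1)`.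
[cite: MadrasSlade1993, Theorem 7.3.2 (proof), (7.3.6)] -/
theorem loopKesten_P1' (M : ℕ) :
    (#((loopSL (M + 1)).filter fun ω' => 1 ≤ #(triSharp ω')) : ℝ) ≤
      ∑ ω ∈ loopSL M, (#(triSlots ω) : ℝ) / max ((#(triSharp ω) : ℝ) - 2) 1 := by
  have hJ : (#((loopSL (M + 1)).filter fun ω' => 1 ≤ #(triSharp ω')) : ℝ) =
      ∑ ω ∈ loopSL (M + 1), (#(triSharp ω) : ℝ) * (1 / (#(triSharp ω) : ℝ)) := by
    rw [card_eq_sum_ones, Nat.cast_sum, sum_filter]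
    refine sum_congr rfl fun ω _ => ?_
    by_cases h : 1 ≤ #(triSharp ω)
    · rw [if_pos h, Nat.cast_one, mul_one_div_cancel]
      exact_mod_cast (show #(triSharp ω) ≠ 0 by omega)
    · rw [if_neg h, show #(triSharp ω) = 0 by omega]
      simp
  rw [hJ, ← sum_loopSharpPairs (M + 1) (fun ω => 1 / (#(triSharp ω) : ℝ)),
    ← sum_loopSlotPairs_eq_sum_loopSharpPairs M (fun p => 1 / (#(triSharp (triIns p.2.1 p.2.2 p.1)) : ℝ))
      (fun q => 1 / (#(triSharp q.1) : ℝ)) (fun p _ => rfl)]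
  have hR : ∑ ω ∈ loopSL M, (#(triSlots ω) : ℝ) / max ((#(triSharp ω) : ℝ) - 2) 1 =
      ∑ p ∈ loopSlotPairs M, 1 / max ((#(triSharp p.1) : ℝ) - 2) 1 := by
    rw [sum_loopSlotPairs M (fun ω => 1 / max ((#(triSharp ω) : ℝ) - 2) 1)]
    refine sum_congr rfl fun ω _ => ?_
    rw [mul_one_div]
  rw [hR]
  refine sum_le_sum fun p hp => ?_
  obtain ⟨ω, m, z⟩ := p
  rw [loopSlotPairs, mem_sigma] at hp
  dsimp only at hp ⊢
  obtain ⟨hω, hs⟩ := hp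
  have hωS := loopSL_subset _ hω
  obtain ⟨hm, -, -, -⟩ := mem_triSlots.1 hs
  have h1 : (1 : ℝ) ≤ #(triSharp (triIns m z ω)) := by exact_mod_cast one_le_card_triSharp_triIns hωS hs
  have h2 : (#(triSharp ω) : ℝ) - 2 ≤ #(triSharp (triIns m z ω)) := by
    have := card_triSharp_le_triIns (z := z) (ω := ω) (le_of_lt hm)
    have h' : (#(triSharp ω) : ℝ) ≤ #(triSharp (triIns m z ω)) + 2 := by exact_mod_cast this
    linarith
  exact one_div_le_one_div_of_le (lt_of_lt_of_le one_pos (le_max_right _ _)) (max_le h2 h1)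

/-- **Level `M+1` of the double transfer over loops**: `Σ_{ω' ∈ loopSL (M+1)} I(ω')/(J(ω')+3) ≤ #loopSL (M+2)`.
[cite: MadrasSlade1993, Theorem 7.3.2 (proof), eq. (7.3.7)] -/
theorem sum_card_triSlots_div_le_card_loopSL (M : ℕ) :
    ∑ ω ∈ loopSL (M + 1), (#(triSlots ω) : ℝ) / ((#(triSharp ω) : ℝ) + 3) ≤ (#(loopSL (M + 2)) : ℝ) := by
  classical
  have e1 : ∑ ω ∈ loopSL (M + 1), (#(triSlots ω) : ℝ) / ((#(triSharp ω) : ℝ) + 3) =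
      ∑ p ∈ loopSlotPairs (M + 1), 1 / ((#(triSharp p.1) : ℝ) + 3) := by
    rw [sum_loopSlotPairs (M + 1) (fun ω => 1 / ((#(triSharp ω) : ℝ) + 3))]
    exact sum_congr rfl fun ω _ => by rw [mul_one_div]
  have e2 : ∑ p ∈ loopSlotPairs (M + 1), 1 / ((#(triSharp p.1) : ℝ) + 3) ≤
      ∑ p ∈ loopSlotPairs (M + 1), 1 / (#(triSharp (triIns p.2.1 p.2.2 p.1)) : ℝ) := by
    refine sum_le_sum fun p hp => ?_
    rw [loopSlotPairs, Finset.mem_sigma] at hp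
    obtain ⟨hω, hs⟩ := hp
    have hωS := loopSL_subset _ hω
    have hs' : (p.2.1, p.2.2) ∈ triSlots p.1 := hs
    have hJ1 := one_le_card_triSharp_triIns hωS hs'
    obtain ⟨hm, -, -, -⟩ := mem_triSlots.1 hs'
    have hJ3 := card_triSharp_triIns_le (z := p.2.2) (ω := p.1) (m := p.2.1) (by omega)
    have hpos : (0 : ℝ) < #(triSharp (triIns p.2.1 p.2.2 p.1)) := by exact_mod_cast hJ1
    apply one_div_le_one_div_of_le hpos
    exact_mod_cast hJ3
  have e3 : ∑ p ∈ loopSlotPairs (M + 1), 1 / (#(triSharp (triIns p.2.1 p.2.2 p.1)) : ℝ) =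
      ∑ q ∈ loopSharpPairs (M + 1 + 1), 1 / (#(triSharp q.1) : ℝ) :=
    sum_loopSlotPairs_eq_sum_loopSharpPairs (M + 1) _ (fun q => 1 / (#(triSharp q.1) : ℝ)) fun p _ => rfl
  have e4 : ∑ q ∈ loopSharpPairs (M + 1 + 1), 1 / (#(triSharp q.1) : ℝ) ≤ (#(loopSL (M + 2)) : ℝ) := by
    rw [sum_loopSharpPairs (M + 1 + 1) (fun ω => 1 / (#(triSharp ω) : ℝ)), show M + 2 = M + 1 + 1 by ring,
      Finset.card_eq_sum_ones, Nat.cast_sum]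
    refine sum_le_sum fun ω _ => ?_
    by_cases h : #(triSharp ω) = 0
    · rw [h]; simp
    · rw [mul_one_div_cancel (by exact_mod_cast h)]; simp
  rw [e1]
  exact e2.trans (e3.le.trans e4)

/-- **(P2-L), the double transfer over loops**: `Σ_{ω ∈ loopSL M} I(ω)·max(0, I(ω) − 8)/((J(ω)+3)(J(ω)+6)) ≤ #loopSL (M+2)`.
[cite: MadrasSlade1993, Theorem 7.3.2 (proof), eq. (7.3.7) (p. 246)] -/
theorem loopKesten_P2 (M : ℕ) :
    ∑ ω ∈ loopSL M, (#(triSlots ω) : ℝ) * max 0 ((#(triSlots ω) : ℝ) - 8) /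
        (((#(triSharp ω) : ℝ) + 3) * ((#(triSharp ω) : ℝ) + 6)) ≤ (#(loopSL (M + 2)) : ℝ) := by
  classical
  refine le_trans ?_ (sum_card_triSlots_div_le_card_loopSL M)
  set g : List (Site 2) → ℝ := fun ω' =>
    (#(triSlots ω') : ℝ) / (((#(triSharp ω') : ℝ) + 3) * (#(triSharp ω') : ℝ)) with hg
  have hB : ∑ ω' ∈ loopSL (M + 1), (#(triSharp ω') : ℝ) * g ω' ≤
      ∑ ω' ∈ loopSL (M + 1), (#(triSlots ω') : ℝ) / ((#(triSharp ω') : ℝ) + 3) := by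
    refine sum_le_sum fun ω' _ => ?_
    by_cases h : #(triSharp ω') = 0
    · rw [h]; simp only [Nat.cast_zero, zero_mul, zero_add]; positivity
    · have hpos : (0 : ℝ) < #(triSharp ω') := by exact_mod_cast Nat.pos_of_ne_zero h
      rw [hg]
      rw [show (#(triSharp ω') : ℝ) * ((#(triSlots ω') : ℝ) /
          (((#(triSharp ω') : ℝ) + 3) * (#(triSharp ω') : ℝ))) =
          (#(triSlots ω') : ℝ) / ((#(triSharp ω') : ℝ) + 3) by field_simp]
  refine le_trans ?_ hB
  rw [← sum_loopSharpPairs (M + 1) g]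
  rw [← sum_loopSlotPairs_eq_sum_loopSharpPairs M (fun p => g (triIns p.2.1 p.2.2 p.1)) (fun q => g q.1) fun p _ => rfl]
  rw [show ∑ ω ∈ loopSL M, (#(triSlots ω) : ℝ) * max 0 ((#(triSlots ω) : ℝ) - 8) /
      (((#(triSharp ω) : ℝ) + 3) * ((#(triSharp ω) : ℝ) + 6)) =
      ∑ ω ∈ loopSL M, (#(triSlots ω) : ℝ) * (max 0 ((#(triSlots ω) : ℝ) - 8) /
      (((#(triSharp ω) : ℝ) + 3) * ((#(triSharp ω) : ℝ) + 6))) from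
    sum_congr rfl fun ω _ => by rw [mul_div_assoc]]
  rw [← sum_loopSlotPairs M (fun ω => max 0 ((#(triSlots ω) : ℝ) - 8) /
      (((#(triSharp ω) : ℝ) + 3) * ((#(triSharp ω) : ℝ) + 6)))]
  refine sum_le_sum fun p hp => ?_
  rw [loopSlotPairs, Finset.mem_sigma] at hp
  obtain ⟨hω, hs⟩ := hp
  have hωS := loopSL_subset _ hω
  have hs' : (p.2.1, p.2.2) ∈ triSlots p.1 := hs
  obtain ⟨hm, -, -, -⟩ := mem_triSlots.1 hs'
  set ω' := triIns p.2.1 p.2.2 p.1 with hω'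
  have hJ1 : (1 : ℝ) ≤ #(triSharp ω') := by exact_mod_cast one_le_card_triSharp_triIns hωS hs'
  have hJ3 : (#(triSharp ω') : ℝ) ≤ #(triSharp p.1) + 3 := by
    exact_mod_cast card_triSharp_triIns_le (z := p.2.2) (ω := p.1) (m := p.2.1) (by omega)
  have hI : (#(triSlots p.1) : ℝ) ≤ #(triSlots ω') + 8 := by
    exact_mod_cast card_triSlots_le_triIns hωS hs'
  have hJ0 : (0 : ℝ) ≤ #(triSharp p.1) := Nat.cast_nonneg _
  have hI0 : (0 : ℝ) ≤ #(triSlots ω') := Nat.cast_nonneg _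
  show max 0 ((#(triSlots p.1) : ℝ) - 8) / (((#(triSharp p.1) : ℝ) + 3) * ((#(triSharp p.1) : ℝ) + 6)) ≤ g ω'
  rw [hg]; simp only
  have hden : ((#(triSharp ω') : ℝ) + 3) * (#(triSharp ω') : ℝ) ≤
      ((#(triSharp p.1) : ℝ) + 3) * ((#(triSharp p.1) : ℝ) + 6) := by nlinarith
  have hden0 : 0 < ((#(triSharp ω') : ℝ) + 3) * (#(triSharp ω') : ℝ) := by positivity
  rcases le_or_gt ((#(triSlots p.1) : ℝ) - 8) 0 with hneg | hpos
  · rw [max_eq_left hneg, zero_div]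
    exact div_nonneg hI0 hden0.le
  · rw [max_eq_right hpos.le]
    calc ((#(triSlots p.1) : ℝ) - 8) / (((#(triSharp p.1) : ℝ) + 3) * ((#(triSharp p.1) : ℝ) + 6))
        ≤ ((#(triSlots p.1) : ℝ) - 8) / (((#(triSharp ω') : ℝ) + 3) * (#(triSharp ω') : ℝ)) :=
          div_le_div_of_nonneg_left hpos.le hden0 hden
      _ ≤ (#(triSlots ω') : ℝ) / (((#(triSharp ω') : ℝ) + 3) * (#(triSharp ω') : ℝ)) :=
          div_le_div_of_nonneg_right (by linarith) hden0.le

end TransferL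

end Literature.Probability.RandomPlanarGeometry.SAW
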